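import Literature.MathematicalPhysics.QuantumFieldTheory.ConformalBootstrap3D.PointKernelK57Data

/-!
# K57 certificate, kernel block file H15: head segments `118 ≤ i < 124` (block-checked ones)

`decide` by kernel reduction (no `native_decide`, no extra axioms) of the block checker
`PCert.hBlockOK` of `PointKernel` on the literal data of `PointKernelK57Data` (cells checked corner
or chord by the rule bit); soundness is `PCert.hBlockOK_sound`.  Estimated kernel time 189 s
(6 theorems).
-/

set_option maxRecDepth 100000
set_option maxHeartbeats 0

namespace Literature.MathematicalPhysics.QuantumFieldTheory.ConformalBootstrap3D.PointKernelK57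

open Literature.MathematicalPhysics.QuantumFieldTheory.ConformalBootstrap3D.PointKernel

/-- head segment `[118, 119)` passes the kernel evaluator (≈24 s of kernel work). [folklore] -/
theorem hBlock_118 : certK57.hBlockOK hsegsK57 118 119 JHK57 = true := by
  decide +kernel

/-- head segment `[119, 120)` passes the kernel evaluator (≈24 s of kernel work). [folklore] -/
theorem hBlock_119 : certK57.hBlockOK hsegsK57 119 120 JHK57 = true := by
  decide +kernel

/-- head segment `[120, 121)` passes the kernel evaluator (≈24 s of kernel work). [folklore] -/
theorem hBlock_120 : certK57.hBlockOK hsegsK57 120 121 JHK57 = true := by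
  decide +kernel

/-- head segment `[121, 122)` passes the kernel evaluator (≈24 s of kernel work). [folklore] -/
theorem hBlock_121 : certK57.hBlockOK hsegsK57 121 122 JHK57 = true := by
  decide +kernel

/-- head segment `[122, 123)` passes the kernel evaluator (≈24 s of kernel work). [folklore] -/
theorem hBlock_122 : certK57.hBlockOK hsegsK57 122 123 JHK57 = true := by
  decide +kernel

/-- head segment `[123, 124)` passes the kernel evaluator (≈24 s of kernel work). [folklore] -/
theorem hBlock_123 : certK57.hBlockOK hsegsK57 123 124 JHK57 = true := by
  decide +kernel

end Literature.MathematicalPhysics.QuantumFieldTheory.ConformalBootstrap3D.PointKernelK57
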